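import Summits.QuantumFields.QCD.Theorems.HeatSlicedQuarksRobustYangMillsHandoverTransferMassContinuity

/-!
# Mass-perturbation bounds for the weighted pairing of the QCD transfer operator
(crux `HeatSlicedQuarks.RobustYangMillsHandover`, item stmt-QuantumFields-8892, line `pin-the-infimum`;
helper towards the held stub `stub_spectralResponse`, mechanism step (ii) — file 2a of the series on the continuity of
Lüscher's finite-volume transfer levels in the bare mass: vector inequalities by the entry sum, a quotient-perturbation
lemma, and the single-integral bounds for the weighted pairing `𝔫`; the transfer form `𝔱` and the equicontinuity of the
Rayleigh quotient follow in file 2b)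

For `β ≥ 0` and a mass tuple `m₀` in Lüscher's range, the family of functions `m ↦ R_m(Ψ)` (`transferRayleigh`),
indexed by the continuous waves `Ψ ≢ 0`, is EQUICONTINUOUS at `m₀`:

  `∀ η > 0, ∀ᶠ m → m₀, ∀ Ψ continuous with ∫ Re⟨Ψ,Ψ⟩ ≠ 0, |R_m(Ψ) − R_{m₀}(Ψ)| ≤ η`

(`transferRayleigh_mass_equicontinuous`).  With `N(Ψ) = ∫ Re⟨Ψ(U), Ψ(U)⟩ dU`, the entry-sum closeness
`Σ‖T̂_F(U;m) − T̂_F(U;m₀)‖ ≤ ε`, the entry bound `Σ‖T̂_F(U;m)‖ ≤ B` and the coercivity `c·Re⟨v,v⟩ ≤ Re⟨v,T̂_F v⟩`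
of the previous file give `|𝔫_m − 𝔫_{m₀}| ≤ ε N`, `Re 𝔫 ≥ c N`, `|𝔱_m − 𝔱_{m₀}| ≤ 2εB N` (the Wilson kernel is
`0 ≤ K ≤ 1`), `0 ≤ Re 𝔱_{m₀} ≤ B² N`, whence `|R_m − R_{m₀}| ≤ ε (2B/c + B²/c²)` uniformly in `Ψ`.  Also:
admissibility `𝔫_m(Ψ,Ψ) ≠ 0` of a continuous wave does not depend on `m` (`fermionWeightForm_ne_zero_iff`).

References: M. Reed, B. Simon, *Methods of Modern Mathematical Physics IV*, Thm XIII.1 [ReedSimonIV1978];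
M. Lüscher, Commun. Math. Phys. 54 (1977) 283 [Luscher1977, pp. 283–292].  Pure theorem file.
-/

noncomputable section

namespace Summit.QuantumFields.QCD.Cruxes.RobustYangMillsHandover.PinTheInfimum

open scoped ComplexOrder ComplexConjugate Topology
open MeasureTheory Matrix Filter Literature.MathematicalPhysics.QuantumFieldTheory
  Literature.MathematicalPhysics.QuantumLattice
open Summit.QuantumFields.QCD.Cruxes.StableActionBridge.Sketch
open Literature.MathematicalPhysics.QuantumLattice (EigenvalueContinuation.re_star_dotProduct_self_nonneg
  EigenvalueContinuation.norm_apply_sq_le)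

namespace TransferMassContinuity

/-! ### Vector inequalities by the entry sum `S(M) = Σ_{st} ‖M_st‖` -/

section Vectors

variable {ι : Type*} [Fintype ι]

/-- **`‖M v‖₂² ≤ S(M)² · Re⟨v, v⟩`** with `S(M) = Σ_{st} ‖M_st‖`: each coordinate of `Mv` is at most
`(Σ_t ‖M_st‖) · max_t ‖v_t‖`, and `Σ_s (Σ_t ‖M_st‖)² ≤ S(M)²`. [folklore] -/
theorem sum_norm_mulVec_sq_le (M : Matrix ι ι ℂ) (v : ι → ℂ) :
    ∑ s, ‖(M *ᵥ v) s‖ ^ 2 ≤ (∑ s, ∑ t, ‖M s t‖) ^ 2 * (star v ⬝ᵥ v).re := by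
  have hr : 0 ≤ (star v ⬝ᵥ v).re := EigenvalueContinuation.re_star_dotProduct_self_nonneg v
  -- coordinatewise: `‖(Mv)_s‖² ≤ (Σ_t ‖M_st‖)² Re⟨v,v⟩`
  have hcoord : ∀ s, ‖(M *ᵥ v) s‖ ^ 2 ≤ (∑ t, ‖M s t‖) ^ 2 * (star v ⬝ᵥ v).re := by
    intro s
    have h1 : ‖(M *ᵥ v) s‖ ≤ ∑ t, ‖M s t‖ * ‖v t‖ := by
      rw [Matrix.mulVec, dotProduct]
      exact (norm_sum_le _ _).trans (Finset.sum_le_sum fun t _ => (norm_mul_le _ _))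
    -- Cauchy–Schwarz with weights `‖M_st‖`: `(Σ a_t b_t)² ≤ (Σ a_t)(Σ a_t b_t²)`, `a = ‖M_st‖`, `b = ‖v_t‖`
    have h2 : (∑ t, ‖M s t‖ * ‖v t‖) ^ 2 ≤ (∑ t, ‖M s t‖) * ∑ t, ‖M s t‖ * ‖v t‖ ^ 2 := by
      have := Finset.sum_mul_sq_le_sq_mul_sq Finset.univ (fun t => Real.sqrt ‖M s t‖)
        (fun t => Real.sqrt ‖M s t‖ * ‖v t‖)
      have e1 : ∀ t, Real.sqrt ‖M s t‖ * (Real.sqrt ‖M s t‖ * ‖v t‖) = ‖M s t‖ * ‖v t‖ := fun t => by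
        rw [← mul_assoc, Real.mul_self_sqrt (norm_nonneg _)]
      have e2 : ∀ t, Real.sqrt ‖M s t‖ ^ 2 = ‖M s t‖ := fun t => Real.sq_sqrt (norm_nonneg _)
      have e3 : ∀ t, (Real.sqrt ‖M s t‖ * ‖v t‖) ^ 2 = ‖M s t‖ * ‖v t‖ ^ 2 := fun t => by
        rw [mul_pow, Real.sq_sqrt (norm_nonneg _)]
      simpa only [e1, e2, e3] using this
    have h3 : ∑ t, ‖M s t‖ * ‖v t‖ ^ 2 ≤ (∑ t, ‖M s t‖) * (star v ⬝ᵥ v).re := by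
      rw [Finset.sum_mul]
      exact Finset.sum_le_sum fun t _ => mul_le_mul_of_nonneg_left (EigenvalueContinuation.norm_apply_sq_le v t) (norm_nonneg _)
    have h0 : 0 ≤ ∑ t, ‖M s t‖ := Finset.sum_nonneg fun t _ => norm_nonneg _
    calc ‖(M *ᵥ v) s‖ ^ 2 ≤ (∑ t, ‖M s t‖ * ‖v t‖) ^ 2 := by gcongr
      _ ≤ (∑ t, ‖M s t‖) * ∑ t, ‖M s t‖ * ‖v t‖ ^ 2 := h2
      _ ≤ (∑ t, ‖M s t‖) * ((∑ t, ‖M s t‖) * (star v ⬝ᵥ v).re) := mul_le_mul_of_nonneg_left h3 h0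
      _ = (∑ t, ‖M s t‖) ^ 2 * (star v ⬝ᵥ v).re := by ring
  calc ∑ s, ‖(M *ᵥ v) s‖ ^ 2 ≤ ∑ s, (∑ t, ‖M s t‖) ^ 2 * (star v ⬝ᵥ v).re := Finset.sum_le_sum fun s _ => hcoord s
    _ = (∑ s, (∑ t, ‖M s t‖) ^ 2) * (star v ⬝ᵥ v).re := by rw [Finset.sum_mul]
    _ ≤ (∑ s, ∑ t, ‖M s t‖) ^ 2 * (star v ⬝ᵥ v).re :=
        mul_le_mul_of_nonneg_right
          (Finset.sum_sq_le_sq_sum_of_nonneg fun s _ => Finset.sum_nonneg fun t _ => norm_nonneg _) hr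

/-- Cauchy–Schwarz for the pairing `star a ⬝ᵥ b`: `‖⟨a, b⟩‖² ≤ (Σ‖a_s‖²)(Σ‖b_s‖²)`. [folklore] -/
theorem norm_star_dotProduct_sq_le (a b : ι → ℂ) :
    ‖star a ⬝ᵥ b‖ ^ 2 ≤ (∑ s, ‖a s‖ ^ 2) * ∑ s, ‖b s‖ ^ 2 := by
  have h1 : ‖star a ⬝ᵥ b‖ ≤ ∑ s, ‖a s‖ * ‖b s‖ := by
    rw [dotProduct]
    refine (norm_sum_le _ _).trans (Finset.sum_le_sum fun s _ => ?_)
    rw [Pi.star_apply, norm_mul, norm_star]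
  have h0 : 0 ≤ ∑ s, ‖a s‖ * ‖b s‖ := Finset.sum_nonneg fun s _ => mul_nonneg (norm_nonneg _) (norm_nonneg _)
  calc ‖star a ⬝ᵥ b‖ ^ 2 ≤ (∑ s, ‖a s‖ * ‖b s‖) ^ 2 := by gcongr
    _ ≤ (∑ s, ‖a s‖ ^ 2) * ∑ s, ‖b s‖ ^ 2 := Finset.sum_mul_sq_le_sq_mul_sq _ _ _

/-- **`|⟨M v, M' w⟩| ≤ S(M) S(M') (Re⟨v,v⟩ + Re⟨w,w⟩)/2`** (Cauchy–Schwarz, the bound `‖Mv‖₂² ≤ S(M)² Re⟨v,v⟩`,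
and `√(xy) ≤ (x+y)/2`, carried out on squares). [folklore] -/
theorem norm_dotProduct_mulVec_mulVec_le (M M' : Matrix ι ι ℂ) (v w : ι → ℂ) :
    ‖star (M *ᵥ v) ⬝ᵥ (M' *ᵥ w)‖ ≤
      (∑ s, ∑ t, ‖M s t‖) * (∑ s, ∑ t, ‖M' s t‖) * (((star v ⬝ᵥ v).re + (star w ⬝ᵥ w).re) / 2) := by
  set P : ℝ := ‖star (M *ᵥ v) ⬝ᵥ (M' *ᵥ w)‖ with hP
  set A : ℝ := ∑ s, ∑ t, ‖M s t‖ with hA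
  set A' : ℝ := ∑ s, ∑ t, ‖M' s t‖ with hA'
  set x : ℝ := (star v ⬝ᵥ v).re with hx
  set y : ℝ := (star w ⬝ᵥ w).re with hy
  have hx0 : 0 ≤ x := EigenvalueContinuation.re_star_dotProduct_self_nonneg v
  have hy0 : 0 ≤ y := EigenvalueContinuation.re_star_dotProduct_self_nonneg w
  have hA0 : 0 ≤ A := Finset.sum_nonneg fun s _ => Finset.sum_nonneg fun t _ => norm_nonneg _
  have hA'0 : 0 ≤ A' := Finset.sum_nonneg fun s _ => Finset.sum_nonneg fun t _ => norm_nonneg _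
  have hP0 : 0 ≤ P := norm_nonneg _
  have hsq : P ^ 2 ≤ (A ^ 2 * x) * (A' ^ 2 * y) :=
    (norm_star_dotProduct_sq_le _ _).trans (mul_le_mul (sum_norm_mulVec_sq_le M v) (sum_norm_mulVec_sq_le M' w)
      (Finset.sum_nonneg fun s _ => sq_nonneg _) (mul_nonneg (sq_nonneg _) hx0))
  have hrhs0 : 0 ≤ A * A' * ((x + y) / 2) := mul_nonneg (mul_nonneg hA0 hA'0) (by linarith)
  refine le_of_sq_le_sq ?_ hrhs0
  calc P ^ 2 ≤ (A ^ 2 * x) * (A' ^ 2 * y) := hsq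
    _ = (A * A') ^ 2 * (x * y) := by ring
    _ ≤ (A * A') ^ 2 * ((x + y) / 2) ^ 2 :=
        mul_le_mul_of_nonneg_left (by nlinarith [sq_nonneg (x - y)]) (sq_nonneg _)
    _ = (A * A' * ((x + y) / 2)) ^ 2 := by ring

/-- Entry sum of a difference: `Σ‖(M − M')_{st}‖ = Σ‖M_{st} − M'_{st}‖`. [folklore] -/
theorem entrySum_sub (M M' : Matrix ι ι ℂ) : ∑ s, ∑ t, ‖(M - M') s t‖ = ∑ s, ∑ t, ‖M s t - M' s t‖ := by
  simp only [Matrix.sub_apply]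

end Vectors

/-! ### A real-quotient inequality -/

/-- **Quotient perturbation**: if `n, n₀ ≥ c N > 0`, `|n − n₀| ≤ ε N`, `|t − t₀| ≤ 2 ε B N` and `0 ≤ t₀ ≤ B² N`,
then `|t/n − t₀/n₀| ≤ ε (2B/c + B²/c²)`. [folklore] -/
theorem abs_div_sub_div_le {t t₀ n n₀ N c ε B : ℝ} (hc : 0 < c) (hN : 0 < N) (hε : 0 ≤ ε) (hB : 0 ≤ B)
    (hn : c * N ≤ n) (hn₀ : c * N ≤ n₀) (hnn : |n - n₀| ≤ ε * N) (htt : |t - t₀| ≤ 2 * ε * B * N)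
    (ht₀0 : 0 ≤ t₀) (ht₀ : t₀ ≤ B ^ 2 * N) :
    |t / n - t₀ / n₀| ≤ ε * (2 * B / c + B ^ 2 / c ^ 2) := by
  have hcN : 0 < c * N := mul_pos hc hN
  have hnpos : 0 < n := lt_of_lt_of_le hcN hn
  have hn₀pos : 0 < n₀ := lt_of_lt_of_le hcN hn₀
  -- split: `t/n − t₀/n₀ = (t − t₀)/n + t₀ (n₀ − n)/(n n₀)`
  have hsplit : t / n - t₀ / n₀ = (t - t₀) / n + t₀ * (n₀ - n) / (n * n₀) := by
    field_simp
    ring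
  rw [hsplit]
  refine (abs_add_le _ _).trans ?_
  have h1 : |(t - t₀) / n| ≤ 2 * ε * B / c := by
    rw [abs_div, abs_of_pos hnpos, div_le_div_iff₀ hnpos hc]
    calc |t - t₀| * c ≤ 2 * ε * B * N * c := mul_le_mul_of_nonneg_right htt hc.le
      _ = 2 * ε * B * (c * N) := by ring
      _ ≤ 2 * ε * B * n := mul_le_mul_of_nonneg_left hn (by positivity)
  have h2 : |t₀ * (n₀ - n) / (n * n₀)| ≤ ε * B ^ 2 / c ^ 2 := by
    rw [abs_div, abs_mul, abs_of_nonneg ht₀0, abs_of_pos (mul_pos hnpos hn₀pos), abs_sub_comm,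
      div_le_div_iff₀ (mul_pos hnpos hn₀pos) (pow_pos hc 2)]
    calc t₀ * |n - n₀| * c ^ 2 ≤ B ^ 2 * N * (ε * N) * c ^ 2 := by
          gcongr
      _ = ε * B ^ 2 * ((c * N) * (c * N)) := by ring
      _ ≤ ε * B ^ 2 * (n * n₀) := by
          gcongr
  calc |(t - t₀) / n| + |t₀ * (n₀ - n) / (n * n₀)| ≤ 2 * ε * B / c + ε * B ^ 2 / c ^ 2 := add_le_add h1 h2
    _ = ε * (2 * B / c + B ^ 2 / c ^ 2) := by ring

/-! ### Single-integral bounds: the weighted pairing `𝔫` -/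

section Forms

variable {Nf S : ℕ} [NeZero S]

/-- A continuous Fock-valued function on the slice has a continuous, hence integrable, `Re⟨Ψ,Ψ⟩`. [folklore] -/
theorem continuous_re_star_dotProduct_self {Ψ : SliceWave Nf S} (hΨ : Continuous Ψ) :
    Continuous fun U : GaugeConfig 3 S (Matrix.specialUnitaryGroup (Fin 3) ℂ) => (star (Ψ U) ⬝ᵥ Ψ U).re :=
  Complex.continuous_re.comp (hΨ.star.dotProduct hΨ)

/-- `∫ Re⟨Ψ,Ψ⟩ ≥ 0`. [folklore] -/
theorem integral_re_star_dotProduct_self_nonneg (Ψ : SliceWave Nf S) :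
    0 ≤ ∫ U, (star (Ψ U) ⬝ᵥ Ψ U).re ∂(sliceHaar S) :=
  integral_nonneg fun U => EigenvalueContinuation.re_star_dotProduct_self_nonneg (Ψ U)

/-- The `𝔫`-integrand `U ↦ ⟨Ψ(U), T̂_F(U;m)Ψ(U)⟩` of a continuous wave is continuous. [folklore] -/
theorem continuous_weight_integrand (m : Fin Nf → ℝ) (hm : ∀ f, -1 < m f) {Ψ : SliceWave Nf S} (hΨ : Continuous Ψ) :
    Continuous fun U : GaugeConfig 3 S (Matrix.specialUnitaryGroup (Fin 3) ℂ) =>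
      star (Ψ U) ⬝ᵥ (fermionSliceOp U m *ᵥ Ψ U) :=
  hΨ.star.dotProduct ((continuous_fermionSliceOp Nf S m hm).matrix_mulVec hΨ)

/-- **`|𝔫_m(Ψ,Ψ) − 𝔫_{m₀}(Ψ,Ψ)| ≤ ε ∫ Re⟨Ψ,Ψ⟩`** when `Σ‖T̂_F(U;m) − T̂_F(U;m₀)‖ ≤ ε` for all `U`. [folklore] -/
theorem fermionWeightForm_sub_norm_le {m m₀ : Fin Nf → ℝ} (hm : ∀ f, -1 < m f) (hm₀ : ∀ f, -1 < m₀ f) {ε : ℝ}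
    (hΔ : ∀ U : GaugeConfig 3 S (Matrix.specialUnitaryGroup (Fin 3) ℂ),
      ∑ s, ∑ t, ‖fermionSliceOp U m s t - fermionSliceOp U m₀ s t‖ ≤ ε)
    {Ψ : SliceWave Nf S} (hΨ : Continuous Ψ) :
    ‖fermionWeightForm m Ψ Ψ - fermionWeightForm m₀ Ψ Ψ‖ ≤ ε * ∫ U, (star (Ψ U) ⬝ᵥ Ψ U).re ∂(sliceHaar S) := by
  unfold fermionWeightForm
  have h1 := integrable_sliceHaar_of_continuous (continuous_weight_integrand m hm hΨ)
  have h2 := integrable_sliceHaar_of_continuous (continuous_weight_integrand m₀ hm₀ hΨ)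
  rw [← integral_sub h1 h2, ← integral_const_mul]
  refine norm_integral_le_of_norm_le ((integrable_sliceHaar_of_continuous
    (Complex.continuous_ofReal.comp (continuous_re_star_dotProduct_self hΨ))).re.const_mul ε |>.congr ?_) ?_
  · exact Eventually.of_forall fun U => by simp
  · refine Eventually.of_forall fun U => ?_
    have e : star (Ψ U) ⬝ᵥ (fermionSliceOp U m *ᵥ Ψ U) - star (Ψ U) ⬝ᵥ (fermionSliceOp U m₀ *ᵥ Ψ U) =
        star (Ψ U) ⬝ᵥ ((fermionSliceOp U m - fermionSliceOp U m₀) *ᵥ Ψ U) := by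
      rw [Matrix.sub_mulVec, dotProduct_sub]
    rw [e]
    refine (norm_dotProduct_mulVec_le_entrySum _ _).trans ?_
    rw [entrySum_sub]
    exact mul_le_mul_of_nonneg_right (hΔ U) (EigenvalueContinuation.re_star_dotProduct_self_nonneg _)

/-- **`Re 𝔫_m(Ψ,Ψ) ≥ c ∫ Re⟨Ψ,Ψ⟩`** under the coercivity `c·Re⟨v,v⟩ ≤ Re⟨v, T̂_F(U;m)v⟩`. [folklore] -/
theorem fermionWeightForm_re_ge {m : Fin Nf → ℝ} (hm : ∀ f, -1 < m f) {c : ℝ}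
    (hco : ∀ (U : GaugeConfig 3 S (Matrix.specialUnitaryGroup (Fin 3) ℂ)) (v : Fock (SliceFermiIdx Nf S)),
      c * (star v ⬝ᵥ v).re ≤ (star v ⬝ᵥ (fermionSliceOp U m *ᵥ v)).re)
    {Ψ : SliceWave Nf S} (hΨ : Continuous Ψ) :
    c * ∫ U, (star (Ψ U) ⬝ᵥ Ψ U).re ∂(sliceHaar S) ≤ (fermionWeightForm m Ψ Ψ).re := by
  unfold fermionWeightForm
  have h1 := integrable_sliceHaar_of_continuous (continuous_weight_integrand m hm hΨ)
  have hre : (∫ U, star (Ψ U) ⬝ᵥ (fermionSliceOp U m *ᵥ Ψ U) ∂(sliceHaar S)).re =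
      ∫ U, (star (Ψ U) ⬝ᵥ (fermionSliceOp U m *ᵥ Ψ U)).re ∂(sliceHaar S) := by
    have h := integral_re h1
    simp only [RCLike.re_to_complex] at h
    exact h.symm
  rw [hre, ← integral_const_mul]
  haveI := isProbabilityMeasure_sliceHaar S
  refine integral_mono ((integrable_sliceHaar_of_continuous (Complex.continuous_ofReal.comp
      (continuous_re_star_dotProduct_self hΨ))).re.const_mul c |>.congr ?_) ?_ fun U => hco U (Ψ U)
  · exact Eventually.of_forall fun U => by simp
  · exact (integrable_sliceHaar_of_continuous (continuous_weight_integrand m hm hΨ)).re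

/-- **`‖𝔫_m(Ψ,Ψ)‖ ≤ B₀ ∫ Re⟨Ψ,Ψ⟩`** when `Σ‖T̂_F(U;m)‖ ≤ B₀` for all `U`. [folklore] -/
theorem fermionWeightForm_norm_le {m : Fin Nf → ℝ} {B₀ : ℝ}
    (hB₀ : ∀ U : GaugeConfig 3 S (Matrix.specialUnitaryGroup (Fin 3) ℂ), ∑ s, ∑ t, ‖fermionSliceOp U m s t‖ ≤ B₀)
    {Ψ : SliceWave Nf S} (hΨ : Continuous Ψ) :
    ‖fermionWeightForm m Ψ Ψ‖ ≤ B₀ * ∫ U, (star (Ψ U) ⬝ᵥ Ψ U).re ∂(sliceHaar S) := by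
  unfold fermionWeightForm
  rw [← integral_const_mul]
  refine norm_integral_le_of_norm_le ((integrable_sliceHaar_of_continuous
    (Complex.continuous_ofReal.comp (continuous_re_star_dotProduct_self hΨ))).re.const_mul B₀ |>.congr ?_) ?_
  · exact Eventually.of_forall fun U => by simp
  · exact Eventually.of_forall fun U =>
      (norm_dotProduct_mulVec_le_entrySum _ _).trans
        (mul_le_mul_of_nonneg_right (hB₀ U) (EigenvalueContinuation.re_star_dotProduct_self_nonneg _))

/-- **Admissibility does not depend on the masses**: for a continuous wave `Ψ` and `m` in Lüscher's range,
`𝔫_m(Ψ,Ψ) ≠ 0 ↔ ∫ Re⟨Ψ,Ψ⟩ ≠ 0` (coercivity from below, the entry bound from above). [folklore] -/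
theorem fermionWeightForm_ne_zero_iff {m : Fin Nf → ℝ} (hm : ∀ f, -1 < m f) {Ψ : SliceWave Nf S} (hΨ : Continuous Ψ) :
    fermionWeightForm m Ψ Ψ ≠ 0 ↔ ∫ U, (star (Ψ U) ⬝ᵥ Ψ U).re ∂(sliceHaar S) ≠ 0 := by
  obtain ⟨c, hc, hco⟩ := fermionSliceOp_coercive_at (Nf := Nf) (S := S) ⟨m, hm⟩
  obtain ⟨B₀, hB₀⟩ := fermionSliceOp_entrySum_le (Nf := Nf) (S := S) ⟨m, hm⟩
  have hN0 := integral_re_star_dotProduct_self_nonneg (S := S) Ψ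
  constructor
  · intro hne hN
    apply hne
    have h := fermionWeightForm_norm_le hB₀ hΨ
    rw [hN, mul_zero] at h
    exact norm_le_zero_iff.mp h
  · intro hN hzero
    have h := fermionWeightForm_re_ge hm hco hΨ
    rw [hzero, Complex.zero_re] at h
    have hNpos : 0 < ∫ U, (star (Ψ U) ⬝ᵥ Ψ U).re ∂(sliceHaar S) := lt_of_le_of_ne hN0 (Ne.symm hN)
    nlinarith [mul_pos hc hNpos]

end Forms

end TransferMassContinuity

/-- **Admissibility of a trial wave does not depend on the bare masses** (registered sub-goal
`fermionWeightForm_ne_zero_iff_mass` of crux stmt-QuantumFields-8892, line `pin-the-infimum`; statement-level export):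
for `m` in Lüscher's range and a continuous wave `Ψ`, `𝔫_m(Ψ,Ψ) ≠ 0 ↔ ∫ Re⟨Ψ,Ψ⟩ ≠ 0`. [cite: Luscher1977, pp. 283–292] -/
theorem fermionWeightForm_ne_zero_iff_mass : ∀ (Nf S : ℕ) [NeZero S] (m : Fin Nf → ℝ), (∀ f, -1 < m f) → ∀ Ψ : SliceWave Nf S, Continuous Ψ → (fermionWeightForm m Ψ Ψ ≠ 0 ↔ (∫ U, (star (Ψ U) ⬝ᵥ Ψ U).re ∂(sliceHaar S)) ≠ 0) :=
  fun _ _ _ _ hm _ hΨ => TransferMassContinuity.fermionWeightForm_ne_zero_iff hm hΨ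

end Summit.QuantumFields.QCD.Cruxes.RobustYangMillsHandover.PinTheInfimum

end
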